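import Literature.NumberTheory.EllipticCurves.BSDInvariantsMinimalModelProofs
import Literature.NumberTheory.EllipticCurves.BSDRootNumberSmallConductorProofs
import Literature.NumberTheory.EllipticCurves.BSDQuadraticDescentShaOddPartGeneralProofs
import HarnessLib

/-!
# Miller's `BSD(E,p)` and `#Ш_an` do not depend on the choice of the global minimal model (PROVED, fact-free)

Miller, LMS J. Comput. Math. 14 (2011), Def. 1.1 states `BSD(E/ℚ, p)` — rank `=` analytic rank,
`Ш(ℚ,E)(p)` finite, `#Ш(ℚ,E)_an ∈ ℚ` and `ord_p #Ш(ℚ,E)_an = ord_p #Ш(ℚ,E)(p)` — for `E` "given by a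
global minimal Weierstrass equation" (loc. cit. §1, first sentence); the tree's `BSDp W p` /
`shaAn W` (`BSDRootNumberSmallConductorProofs.lean`) are these notions read on a MODEL `W`. This file
proves, with NO named fact and NO new definition, that they agree on any two globally minimal models
of one curve: for `W` elliptic and globally minimal and `C • W` globally minimal,

* `shaAn_variableChange_of_isGloballyMinimal : shaAn (C • W) = shaAn W`;
* `bsdp_variableChange_iff_of_isGloballyMinimal : BSDp (C • W) p ↔ BSDp W p` (every `p : ℕ`);
* the door forms `bsdp_iff_of_smul_eq_of_isGloballyMinimal (hC : C • W₀ = W) : BSDp W p ↔ BSDp W₀ p`,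
  `shaAn_eq_of_smul_eq_of_isGloballyMinimal`, `forall_bsdp_iff_of_smul_eq_of_isGloballyMinimal`.

Ingredients, all landed DISCHARGES of the invariance facts of `BSDInvariants.lean` (Silverman, *AEC*,
III.3.1(b), VII.1.3(b), VIII.9.3, X.§4, C.16): `mordellWeilRank_variableChange_holds`,
`analyticRank_variableChange_holds`, `leadingLCoeff_variableChange_holds`,
`torsionOrder_variableChange_holds`, `tamagawaProduct_variableChange_holds`,
`regulator_variableChange_holds`, `realPeriodRat_variableChange_of_isGloballyMinimal_holds` (the only
place minimality enters: `Ω(C • W) = |u|·Ω(W)` and `u = ±1` between minimal models), and for the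
`p`-primary part of `Ш` the landed `card_primaryComponent_sha_variableChange` /
`finite_primaryComponent_sha_variableChange` (`BSDQuadraticDescentShaOddPartGeneralProofs.lean`:
`Ш(W) ≃+ Ш(C • W)` restricts to the `p`-primary components).

WHY (cell `bsd-print-cf2`, typer ty2 = discharge interface, partition leaf CornerF @ `p = 2`): the
printed theorems at `2` (Li–Liu–Tian 2024 Thm. 1.2, Tian 2014 Thm. 1.3, Tian–Yuan–Zhang 2017
Thms. 1.1/1.2) are typed on the named models `congruentNumberCurve n` / `sylvesterCurve p`, while the
partition leaf quantifies over an ARBITRARY globally minimal `W`; the existing transport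
`Summit.…P2.bsdp_two_of_smul_eq` goes through ISOGENY invariance and therefore displays three named
facts (Gross–Zagier–Kolyvagin, Cassels 1965, modularity). For a mere change of variables none is
needed — this file. Nothing here is specific to `p = 2`.

## References
* [Miller2011LMS] R. L. Miller, LMS J. Comput. Math. 14 (2011) 327–350, §1 and Def. 1.1
  (arXiv:1010.2431 p. 3): `#Ш_an`, `BSD(E,p)`, "global minimal Weierstrass equation".
* [SilvermanAEC2009] J. H. Silverman, GTM 106, 2nd ed.: III.3.1(b), VII.1.3(b), VIII.8, X.§4, C.16.
-/

noncomputable section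

open scoped Classical

namespace WeierstrassCurve

open Literature.NumberTheory.EllipticCurves

universe u

/-! ### The `p`-primary part of `Ш` under a change of variables (iff form) -/

section Sha

variable {K : Type u} [Field K] [NumberField K] (W : WeierstrassCurve K) (C : VariableChange K)

/-- `Ш(C • W)(p)` is finite iff `Ш(W)(p)` is (both directions of the landed
`finite_primaryComponent_sha_variableChange`, the converse through `C⁻¹ • (C • W) = W`).
[cite: SilvermanAEC2009, X.§4 (definition of Ш, Rem. 4.1.1)] -/
theorem finite_primaryComponent_sha_variableChange_iff (p : ℕ) :
    Finite (AddCommGroup.primaryComponent (C • W).sha p) ↔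
      Finite (AddCommGroup.primaryComponent W.sha p) := by
  refine ⟨fun h => ?_, fun h => finite_primaryComponent_sha_variableChange W C p⟩
  have h' := finite_primaryComponent_sha_variableChange (C • W) C⁻¹ p
  rwa [inv_smul_smul] at h'

end Sha

/-! ### `#Ш_an` and `BSD(E,p)` on two global minimal models over `ℚ` -/

section Rat

variable (W : WeierstrassCurve ℚ) [W.IsElliptic]

/-- **Miller's `#Ш_an` is the same on any two global minimal models**: for `W` and `C • W` both
globally minimal, `shaAn (C • W) = shaAn W` — `L^{(r)}(E,1)/r!`, `#E(ℚ)_tors`, `∏ c_ℓ`, `Reg` are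
invariant under every admissible change of variables and `Ω` under those between minimal models
(`u = ±1`). Fact-free. [cite: Miller2011LMS, §1 (arXiv:1010.2431 p. 3)]
[cite: SilvermanAEC2009, Conj. C.16.5 with Prop. VII.1.3(b)] -/
theorem shaAn_variableChange_of_isGloballyMinimal [W.IsGloballyMinimal] (C : VariableChange ℚ)
    [(C • W).IsGloballyMinimal] : shaAn (C • W) = shaAn W := by
  have hlead : (C • W).leadingLCoeff = W.leadingLCoeff := leadingLCoeff_variableChange_holds W C
  have htor : (C • W).torsionOrder = W.torsionOrder := torsionOrder_variableChange_holds W C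
  have hper : (C • W).realPeriodRat = W.realPeriodRat :=
    realPeriodRat_variableChange_of_isGloballyMinimal_holds W C
  have htam : (C • W).tamagawaProduct = W.tamagawaProduct :=
    tamagawaProduct_variableChange_holds W C
  have hreg : (C • W).regulator = W.regulator := regulator_variableChange_holds W C
  rw [shaAn_def, shaAn_def, hlead, htor, hper, htam, hreg]

/-- **Miller's `BSD(E,p)` is the same on any two global minimal models** (every `p : ℕ`): for `W`
elliptic and globally minimal and `C • W` globally minimal, `BSDp (C • W) p ↔ BSDp W p`. Rank and
analytic rank are isomorphism invariants, `Ш(C • W)(p) ≃+ Ш(W)(p)`, and `#Ш_an` agrees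
(`shaAn_variableChange_of_isGloballyMinimal`). Fact-free: no Cassels, no Gross–Zagier–Kolyvagin,
no modularity. [cite: Miller2011LMS, Def. 1.1 (arXiv:1010.2431 p. 3)]
[cite: SilvermanAEC2009, Conj. C.16.5 with Prop. VII.1.3(b)] -/
theorem bsdp_variableChange_iff_of_isGloballyMinimal [W.IsGloballyMinimal] (C : VariableChange ℚ)
    [(C • W).IsGloballyMinimal] (p : ℕ) : BSDp (C • W) p ↔ BSDp W p := by
  have hran : (C • W).analyticRank = W.analyticRank := analyticRank_variableChange_holds W C
  have hmw : (C • W).mordellWeilRank = W.mordellWeilRank := mordellWeilRank_variableChange_holds W C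
  rw [bsdp_iff, bsdp_iff, hran, hmw, shaAn_variableChange_of_isGloballyMinimal W C,
    finite_primaryComponent_sha_variableChange_iff W C p,
    card_primaryComponent_sha_variableChange W C p]

/-- **Door form.** If `C • W₀ = W` with `W₀` elliptic and globally minimal and `W` globally minimal
(e.g. `W₀` a named minimal model such as `congruentNumberCurve n`, `W` any globally minimal model of
the same curve), then `BSDp W p ↔ BSDp W₀ p` for every `p`. Fact-free.
[cite: Miller2011LMS, Def. 1.1 (arXiv:1010.2431 p. 3)] -/
theorem bsdp_iff_of_smul_eq_of_isGloballyMinimal {W₀ W : WeierstrassCurve ℚ} [W₀.IsElliptic]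
    [W₀.IsGloballyMinimal] [W.IsGloballyMinimal] {C : VariableChange ℚ} (hC : C • W₀ = W) (p : ℕ) :
    BSDp W p ↔ BSDp W₀ p := by
  subst hC
  exact bsdp_variableChange_iff_of_isGloballyMinimal W₀ C p

/-- **Door form for `#Ш_an`.** Under the same hypotheses `shaAn W = shaAn W₀`. Fact-free.
[cite: Miller2011LMS, §1 (arXiv:1010.2431 p. 3)] -/
theorem shaAn_eq_of_smul_eq_of_isGloballyMinimal {W₀ W : WeierstrassCurve ℚ} [W₀.IsElliptic]
    [W₀.IsGloballyMinimal] [W.IsGloballyMinimal] {C : VariableChange ℚ} (hC : C • W₀ = W) :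
    shaAn W = shaAn W₀ := by
  subst hC
  exact shaAn_variableChange_of_isGloballyMinimal W₀ C

/-- **All primes at once.** For `C • W₀ = W` as above, `(∀ p prime, BSDp W p) ↔ (∀ p prime, BSDp W₀ p)`.
Fact-free. [cite: Miller2011LMS, Def. 1.1 (arXiv:1010.2431 p. 3)] -/
theorem forall_bsdp_iff_of_smul_eq_of_isGloballyMinimal {W₀ W : WeierstrassCurve ℚ} [W₀.IsElliptic]
    [W₀.IsGloballyMinimal] [W.IsGloballyMinimal] {C : VariableChange ℚ} (hC : C • W₀ = W) :
    (∀ p : ℕ, p.Prime → BSDp W p) ↔ ∀ p : ℕ, p.Prime → BSDp W₀ p :=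
  forall₂_congr fun p _ => bsdp_iff_of_smul_eq_of_isGloballyMinimal hC p

/-! ### Two global minimal models of ONE (possibly non-minimal) equation

The printed twist families (Shu–Zhai 2021, Cai–Li–Zhai 2020, Kriz–Li 2019, Coates–Li–Tian–Zhai
2015) are stated for "the twist `E^{(d)}`", i.e. for the CURVE; the tree's named model
`E₀.quadraticTwist d` is in general NOT globally minimal (at `2`), and the facts are typed on
globally minimal models `W'` with `C • E₀.quadraticTwist d = W'` (Pal 2012 pattern). Two such models
are related by a change of variables, so `BSD(·,p)` agrees on them — fact-free. -/

/-- Two models `W₁`, `W₂` of one equation `V` (`C₁ • V = W₁`, `C₂ • V = W₂`) differ by the change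
of variables `C₂ * C₁⁻¹` (private plumbing). [folklore] -/
private theorem smul_eq_of_smul_eq_of_smul_eq {R : Type*} [CommRing R] {V W₁ W₂ : WeierstrassCurve R}
    {C₁ C₂ : VariableChange R} (h₁ : C₁ • V = W₁) (h₂ : C₂ • V = W₂) :
    (C₂ * C₁⁻¹) • W₁ = W₂ := by
  rw [← h₁, ← h₂, mul_smul, inv_smul_smul]

/-- **`BSD(·,p)` agrees on any two global minimal models of one equation**: if `C₁ • V = W₁` and
`C₂ • V = W₂` with `W₁` elliptic and `W₁`, `W₂` globally minimal (no hypothesis on the model `V`,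
e.g. `V = E₀.quadraticTwist d`), then `BSDp W₂ p ↔ BSDp W₁ p` for every `p`. Fact-free.
[cite: Miller2011LMS, Def. 1.1 (arXiv:1010.2431 p. 3)] -/
theorem bsdp_iff_of_smul_eq_of_smul_eq_of_isGloballyMinimal {V W₁ W₂ : WeierstrassCurve ℚ}
    [W₁.IsElliptic] [W₁.IsGloballyMinimal] [W₂.IsGloballyMinimal] {C₁ C₂ : VariableChange ℚ}
    (h₁ : C₁ • V = W₁) (h₂ : C₂ • V = W₂) (p : ℕ) : BSDp W₂ p ↔ BSDp W₁ p :=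
  bsdp_iff_of_smul_eq_of_isGloballyMinimal (smul_eq_of_smul_eq_of_smul_eq h₁ h₂) p

/-- `#Ш_an` agrees on any two global minimal models of one equation (same hypotheses). Fact-free.
[cite: Miller2011LMS, §1 (arXiv:1010.2431 p. 3)] -/
theorem shaAn_eq_of_smul_eq_of_smul_eq_of_isGloballyMinimal {V W₁ W₂ : WeierstrassCurve ℚ}
    [W₁.IsElliptic] [W₁.IsGloballyMinimal] [W₂.IsGloballyMinimal] {C₁ C₂ : VariableChange ℚ}
    (h₁ : C₁ • V = W₁) (h₂ : C₂ • V = W₂) : shaAn W₂ = shaAn W₁ :=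
  shaAn_eq_of_smul_eq_of_isGloballyMinimal (smul_eq_of_smul_eq_of_smul_eq h₁ h₂)

/-- **A fact stated on ONE global minimal model of `V` holds on ALL of them**: from
`∃ W₁` globally minimal elliptic with `C₁ • V = W₁` and `BSDp W₁ p`, every globally minimal `W₂`
with `C₂ • V = W₂` satisfies `BSDp W₂ p`. Fact-free glue for twist-family facts.
[cite: Miller2011LMS, Def. 1.1 (arXiv:1010.2431 p. 3)] -/
theorem bsdp_of_exists_minimal_model {V W₂ : WeierstrassCurve ℚ} [W₂.IsGloballyMinimal]
    {C₂ : VariableChange ℚ} (h₂ : C₂ • V = W₂) {p : ℕ}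
    (h : ∃ (W₁ : WeierstrassCurve ℚ) (_ : W₁.IsElliptic) (_ : W₁.IsGloballyMinimal)
      (C₁ : VariableChange ℚ), C₁ • V = W₁ ∧ BSDp W₁ p) : BSDp W₂ p := by
  obtain ⟨W₁, _, _, C₁, h₁, hB⟩ := h
  exact (bsdp_iff_of_smul_eq_of_smul_eq_of_isGloballyMinimal h₁ h₂ p).2 hB

end Rat

end WeierstrassCurve

end
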